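import Literature.Probability.RandomPlanarGeometry.ChordalBoundary
import Literature.Probability.RandomPlanarGeometry.ConformalRectangleProofs
import Literature.Probability.RandomPlanarGeometry.RectangleModulusProofs
import HarnessLib

/-!
# Normalising the boundary preimages of a uniformizing datum by a real Möbius map

Topic `Literature/Probability/RandomPlanarGeometry`. Every conformal rectangle `R` admits a
uniformizing datum whose four boundary preimages are the Schwarz–Christoffel prevertices
`±(-1/k, -1, 1, 1/k)` of the rectangle map `scrFun k` of `RectangleSCIntegrand.lean`
(`exists_isUniformizing_scrPrevertex`): start from any datum `(ψ₀, x)`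
(`MarkedDomain.exists_isUniformizing_holds`), choose `k` with `((1-k)/(1+k))² = crossRatio x`,
and precompose `ψ₀` with the real Möbius self-map `N` of `ℍₒ` carrying three of the prevertices
to `x 0, x 1, x 2` (`exists_isUniformizing_of_crossRatio_eq`, three-point transitivity of
`PSL(2, ℝ)` on ordered triples, with the explicit matrix `moebA/B/C/D`); the fourth prevertex
then goes to `x 3` because the cross-ratios agree (`moebNum_sub_eq`). Ahlfors, *Complex Analysis*
(1979), Ch. 3 §3.1 (a linear transformation is determined by three points; the cross-ratio is
invariant). Everything is PROVED; the boundary values are transferred by the tree's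
`ConformalEquiv.hasBoundaryValue_realMobius_trans` (`ChordalBoundary.lean`).

## References

* L. V. Ahlfors, *Complex Analysis*, 3rd ed. (1979), Ch. 3 §3.1.
* B. Bollobás, O. Riordan, *Percolation* (2006), Ch. 7 §7.1 (the prevertices of `U₄(k)`).
  [folklore]
-/

noncomputable section

open Set Filter Topology Complex Metric
open UpperHalfPlane (upperHalfPlaneSet)

namespace Literature.Probability.RandomPlanarGeometry

namespace UniformizingNormalForm

/-! ### The three-point Möbius map: algebra -/

section Algebra

variable (x y : Fin 4 → ℝ)

/-- Auxiliary products `P = (x₁-x₀)(y₁-y₂)`, `Q = (x₁-x₂)(y₁-y₀)`; the matrix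
`(a b; c d) = (P x₂ - Q x₀, -P x₂ y₀ + Q x₀ y₂; P - Q, -P y₀ + Q y₂)` of the real Möbius map
`N = T_x⁻¹ ∘ T_y` (`T_t : t₀, t₁, t₂ ↦ 0, 1, ∞`) with `N (y i) = x i`, `i = 0, 1, 2`. We use the
entries as explicit expressions (no definitions). The determinant factorises:
`ad - bc = P Q (x₂ - x₀)(y₂ - y₀)`. [folklore] -/
theorem det_eq :
    ((x 1 - x 0) * (y 1 - y 2) * x 2 - (x 1 - x 2) * (y 1 - y 0) * x 0) *
        (-((x 1 - x 0) * (y 1 - y 2)) * y 0 + (x 1 - x 2) * (y 1 - y 0) * y 2) -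
      (-((x 1 - x 0) * (y 1 - y 2)) * x 2 * y 0 + (x 1 - x 2) * (y 1 - y 0) * x 0 * y 2) *
        ((x 1 - x 0) * (y 1 - y 2) - (x 1 - x 2) * (y 1 - y 0)) =
      (x 1 - x 0) * (y 1 - y 2) * ((x 1 - x 2) * (y 1 - y 0)) * (x 2 - x 0) * (y 2 - y 0) := by
  ring

/-- The determinant is positive when `x` and `y` are strictly monotone in the same direction on
the indices `0, 1, 2`. [folklore] -/
theorem det_pos (h : (x 0 < x 1 ∧ x 1 < x 2 ∧ y 0 < y 1 ∧ y 1 < y 2) ∨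
    (x 1 < x 0 ∧ x 2 < x 1 ∧ y 1 < y 0 ∧ y 2 < y 1)) :
    0 < ((x 1 - x 0) * (y 1 - y 2) * x 2 - (x 1 - x 2) * (y 1 - y 0) * x 0) *
        (-((x 1 - x 0) * (y 1 - y 2)) * y 0 + (x 1 - x 2) * (y 1 - y 0) * y 2) -
      (-((x 1 - x 0) * (y 1 - y 2)) * x 2 * y 0 + (x 1 - x 2) * (y 1 - y 0) * x 0 * y 2) *
        ((x 1 - x 0) * (y 1 - y 2) - (x 1 - x 2) * (y 1 - y 0)) := by
  rw [det_eq]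
  rcases h with ⟨h1, h2, h3, h4⟩ | ⟨h1, h2, h3, h4⟩
  · have e : (x 1 - x 0) * (y 1 - y 2) * ((x 1 - x 2) * (y 1 - y 0)) * (x 2 - x 0) * (y 2 - y 0)
        = ((x 1 - x 0) * (y 2 - y 1)) * ((x 2 - x 1) * (y 1 - y 0)) * ((x 2 - x 0) * (y 2 - y 0)) := by
      ring
    rw [e]
    apply mul_pos (mul_pos (mul_pos (by linarith) (by linarith)) (mul_pos (by linarith) (by linarith)))
      (mul_pos (by linarith) (by linarith))
  · have e : (x 1 - x 0) * (y 1 - y 2) * ((x 1 - x 2) * (y 1 - y 0)) * (x 2 - x 0) * (y 2 - y 0)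
        = ((x 0 - x 1) * (y 1 - y 2)) * ((x 1 - x 2) * (y 0 - y 1)) * ((x 0 - x 2) * (y 0 - y 2)) := by
      ring
    rw [e]
    apply mul_pos (mul_pos (mul_pos (by linarith) (by linarith)) (mul_pos (by linarith) (by linarith)))
      (mul_pos (by linarith) (by linarith))

/-- **The fourth point**: the key polynomial identity
`(a y₃ + b) - x₃ (c y₃ + d) = (x₀-x₁)(x₂-x₃)(y₀-y₂)(y₁-y₃) - (y₀-y₁)(y₂-y₃)(x₀-x₂)(x₁-x₃)`, whose
right-hand side vanishes exactly when `crossRatio x = crossRatio y`. [folklore] -/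
theorem moebNum_sub_eq :
    ((x 1 - x 0) * (y 1 - y 2) * x 2 - (x 1 - x 2) * (y 1 - y 0) * x 0) * y 3 +
          (-((x 1 - x 0) * (y 1 - y 2)) * x 2 * y 0 + (x 1 - x 2) * (y 1 - y 0) * x 0 * y 2) -
        x 3 * (((x 1 - x 0) * (y 1 - y 2) - (x 1 - x 2) * (y 1 - y 0)) * y 3 +
          (-((x 1 - x 0) * (y 1 - y 2)) * y 0 + (x 1 - x 2) * (y 1 - y 0) * y 2)) =
      (x 0 - x 1) * (x 2 - x 3) * (y 0 - y 2) * (y 1 - y 3) -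
        (y 0 - y 1) * (y 2 - y 3) * (x 0 - x 2) * (x 1 - x 3) := by
  ring

/-- Equal cross-ratios of injective tuples clear denominators:
`(x₀-x₁)(x₂-x₃)(y₀-y₂)(y₁-y₃) = (y₀-y₁)(y₂-y₃)(x₀-x₂)(x₁-x₃)`. [folklore] -/
theorem cross_eq_of_crossRatio_eq (hx : Function.Injective x) (hy : Function.Injective y)
    (h : crossRatio x = crossRatio y) :
    (x 0 - x 1) * (x 2 - x 3) * (y 0 - y 2) * (y 1 - y 3) =
      (y 0 - y 1) * (y 2 - y 3) * (x 0 - x 2) * (x 1 - x 3) := by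
  have hx02 : x 0 - x 2 ≠ 0 := sub_ne_zero.2 (hx.ne (by decide))
  have hx13 : x 1 - x 3 ≠ 0 := sub_ne_zero.2 (hx.ne (by decide))
  have hy02 : y 0 - y 2 ≠ 0 := sub_ne_zero.2 (hy.ne (by decide))
  have hy13 : y 1 - y 3 ≠ 0 := sub_ne_zero.2 (hy.ne (by decide))
  simp only [crossRatio] at h
  rw [div_eq_div_iff (mul_ne_zero hx02 hx13) (mul_ne_zero hy02 hy13)] at h
  linarith

end Algebra

/-! ### The normalised data -/

/-- **Three-point normalisation of a uniformizing datum.** If `(ψ₀, x)` uniformizes the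
conformal rectangle `R` and `y` is a real quadruple, strictly monotone in the same direction as
`x`, with the same cross-ratio, then `R` has a uniformizing datum with boundary preimages `y`:
`ψ = ψ₀ ∘ N` with `N` the real Möbius map of `ℍₒ` taking `y 0, y 1, y 2` to `x 0, x 1, x 2`
(and then `y 3` to `x 3`). Ahlfors (1979), Ch. 3 §3.1. [folklore] -/
theorem exists_isUniformizing_of_crossRatio_eq (R : ConformalRectangle)
    {ψ₀ : ConformalEquiv upperHalfPlaneSet R.carrier} {x y : Fin 4 → ℝ}
    (h₀ : R.IsUniformizing ψ₀ x)
    (hxy : (StrictMono x ∧ StrictMono y) ∨ (StrictAnti x ∧ StrictAnti y))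
    (hcr : crossRatio x = crossRatio y) :
    ∃ ψ : ConformalEquiv upperHalfPlaneSet R.carrier, R.IsUniformizing ψ y := by
  have hxinj : Function.Injective x := h₀.injective
  have hy : StrictMono y ∨ StrictAnti y := hxy.elim (fun h => Or.inl h.2) fun h => Or.inr h.2
  have hyinj : Function.Injective y := hy.elim StrictMono.injective StrictAnti.injective
  have h01 : (0 : Fin 4) < 1 := by decide
  have h12 : (1 : Fin 4) < 2 := by decide
  -- the matrix entries
  set P : ℝ := (x 1 - x 0) * (y 1 - y 2) with hP
  set Q : ℝ := (x 1 - x 2) * (y 1 - y 0) with hQ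
  set a : ℝ := P * x 2 - Q * x 0 with ha
  set b : ℝ := -P * x 2 * y 0 + Q * x 0 * y 2 with hb
  set c : ℝ := P - Q with hc
  set d : ℝ := -P * y 0 + Q * y 2 with hd
  have hdet : 0 < a * d - b * c := by
    have h := det_pos x y (hxy.elim (fun h => Or.inl ⟨h.1 h01, h.1 h12, h.2 h01, h.2 h12⟩)
      fun h => Or.inr ⟨h.1 h01, h.1 h12, h.2 h01, h.2 h12⟩)
    simp only [ha, hb, hc, hd, hP, hQ]
    convert h using 1
  have hPne : P ≠ 0 := mul_ne_zero (sub_ne_zero.2 (hxinj.ne (by decide)))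
    (sub_ne_zero.2 (hyinj.ne (by decide)))
  have hQne : Q ≠ 0 := mul_ne_zero (sub_ne_zero.2 (hxinj.ne (by decide)))
    (sub_ne_zero.2 (hyinj.ne (by decide)))
  -- `N (y i) = x i`, written multiplicatively, and the denominators
  have hnum0 : a * y 0 + b = x 0 * (c * y 0 + d) := by simp only [ha, hb, hc, hd]; ring
  have hnum1 : a * y 1 + b = x 1 * (c * y 1 + d) := by simp only [ha, hb, hc, hd, hP, hQ]; ring
  have hnum2 : a * y 2 + b = x 2 * (c * y 2 + d) := by simp only [ha, hb, hc, hd]; ring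
  have hnum3 : a * y 3 + b = x 3 * (c * y 3 + d) := by
    have key := moebNum_sub_eq x y
    rw [cross_eq_of_crossRatio_eq x y hxinj hyinj hcr, sub_self] at key
    simp only [ha, hb, hc, hd, hP, hQ]
    linear_combination key
  have hnum : ∀ i : Fin 4, a * y i + b = x i * (c * y i + d) := by
    intro i
    fin_cases i
    · exact hnum0
    · exact hnum1
    · exact hnum2
    · exact hnum3
  have hden : ∀ i : Fin 4, c * y i + d ≠ 0 := by
    intro i
    fin_cases i
    · have e : c * y 0 + d = Q * (y 2 - y 0) := by simp only [hc, hd]; ring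
      simp only [Fin.zero_eta, Fin.isValue]
      rw [e]; exact mul_ne_zero hQne (sub_ne_zero.2 (hyinj.ne (by decide)))
    · have e : c * y 1 + d = (y 1 - y 2) * (y 1 - y 0) * (x 2 - x 0) := by
        simp only [hc, hd, hP, hQ]; ring
      simp only [Fin.mk_one, Fin.isValue]
      rw [e]
      exact mul_ne_zero (mul_ne_zero (sub_ne_zero.2 (hyinj.ne (by decide)))
        (sub_ne_zero.2 (hyinj.ne (by decide)))) (sub_ne_zero.2 (hxinj.ne (by decide)))
    · have e : c * y 2 + d = P * (y 2 - y 0) := by simp only [hc, hd]; ring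
      simp only [Fin.reduceFinMk, Fin.isValue]
      rw [e]; exact mul_ne_zero hPne (sub_ne_zero.2 (hyinj.ne (by decide)))
    · simp only [Fin.reduceFinMk, Fin.isValue]
      intro h0
      have h1 : a * y 3 + b = 0 := by rw [hnum 3, h0, mul_zero]
      have h2 : a * d - b * c = 0 := by
        have hd' : d = -(c * y 3) := by linarith
        have hb' : b = -(a * y 3) := by linarith
        rw [hd', hb']; ring
      exact hdet.ne' h2
  refine ⟨(ConformalEquiv.realMobius a b c d hdet).trans ψ₀, hy, fun i => ?_⟩
  refine ConformalEquiv.hasBoundaryValue_realMobius_trans hdet ψ₀ (hden i) ?_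
  rw [eq_div_of_mul_eq (hden i) (hnum i).symm |>.symm]
  exact h₀.2 i

/-- **Every conformal rectangle has a uniformizing datum with Schwarz–Christoffel prevertices**
`± (-1/k, -1, 1, 1/k)`, `0 < k < 1` (sign `+` for an increasing datum, `-` for a decreasing
one): `k = (1 - √η)/(1 + √η)` with `η ∈ (0, 1)` the cross-ratio modulus of `R`. [folklore] -/
theorem exists_isUniformizing_scrPrevertex (R : ConformalRectangle) :
    ∃ (k s : ℝ) (ψ : ConformalEquiv upperHalfPlaneSet R.carrier), 0 < k ∧ k < 1 ∧
      (s = 1 ∨ s = -1) ∧ R.IsUniformizing ψ (fun i => s * scrPrevertex k i) := by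
  obtain ⟨ψ₀, x, h₀⟩ := MarkedDomain.exists_isUniformizing_holds R
  have hη := ConformalRectangle.crossRatio_mem_Ioo_of_isUniformizing h₀
  set η := crossRatio x with hηdef
  set r := Real.sqrt η with hr
  have hr0 : 0 < r := Real.sqrt_pos.2 hη.1
  have hr1 : r < 1 := by
    rw [hr, show (1 : ℝ) = Real.sqrt 1 by simp]
    exact Real.sqrt_lt_sqrt hη.1.le hη.2
  set k := (1 - r) / (1 + r) with hk
  have hk0 : 0 < k := div_pos (by linarith) (by linarith)
  have hk1 : k < 1 := by rw [hk, div_lt_one (by linarith)]; linarith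
  have hcrk : crossRatio (scrPrevertex k) = η := by
    rw [crossRatio_scrPrevertex hk0 hk1]
    have e : (1 - k) / (1 + k) = r := by
      rw [hk]; field_simp; ring
    rw [← div_pow, e, hr, Real.sq_sqrt hη.1.le]
  rcases h₀.1 with hx | hx
  · obtain ⟨ψ, hψ⟩ := exists_isUniformizing_of_crossRatio_eq R h₀
      (Or.inl ⟨hx, strictMono_scrPrevertex hk0 hk1⟩) (by rw [hcrk])
    exact ⟨k, 1, ψ, hk0, hk1, Or.inl rfl, by simpa using hψ⟩
  · have hanti : StrictAnti fun i => -1 * scrPrevertex k i := by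
      intro i j hij
      have := strictMono_scrPrevertex hk0 hk1 hij
      linarith
    obtain ⟨ψ, hψ⟩ := exists_isUniformizing_of_crossRatio_eq R h₀ (Or.inr ⟨hx, hanti⟩) (by
      have e : (fun i => -1 * scrPrevertex k i) = -scrPrevertex k := by
        funext i; simp
      rw [e, crossRatio_neg, hcrk])
    exact ⟨k, -1, ψ, hk0, hk1, Or.inr rfl, hψ⟩

end UniformizingNormalForm

end Literature.Probability.RandomPlanarGeometry
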